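import Summits.AtomisticToContinuum.Crystallization.Theorems.FluxTubeKeplerFloorGivesLayered
import Summits.AtomisticToContinuum.Crystallization.Theorems.FluxTubeKeplerFluxCellKeplerSingleScale

/-!
# `DecayingMarginRung` — F3 special-case certificate (no `sorry`)

Forward rung over `FluxTubeKepler.FloorGivesLayered` (crux dir `FluxCellKepler`, stmt-AtomisticToContinuum-15221;
fwd-rung G1 gen 10).  This file re-declares the rung family of `Lines/DecayingMarginRung.lean` in its own namespace
(`…MarginLadder.Special`, so that it never collides with the skeleton file) and proves, sorry-free:

* `marginBudget_zero_iff` — at exponent `s = 0` the margin budget IS the floor's budget (`N^0 = 1`, `Real.rpow_zero`):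
  the dial value `0` is the floor by one hypothesis move, no re-indexing;
* `marginRung_zero : MarginRung 0` — **the F3 witness**: the floor's proved theorem
  `FluxTubeKeplerFloorGivesLayered.FloorGivesLayered_proof` composed with the proved `PeriodicGivenLayered_holds`;
* `marginRung_anti` — the dial is antitone in `s` (under FLOOR a budget with a larger exponent is a weaker hypothesis,
  so the rung with larger `s` is the stronger statement); `marginRung_zero_of_decayingMarginRung` — the rung gives back
  the floor.
-/

noncomputable section

namespace Summit.AtomisticToContinuum.Crystallization.Cruxes.FluxCellKepler.MarginLadder.Special

open Filter Topology
open Literature.MathematicalPhysics.StatisticalMechanics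
open Summit.AtomisticToContinuum.Crystallization.Theorems.FluxCellKeplerSingleScale (LayeredGood)

local notation "E3" => EuclideanSpace ℝ (Fin 3)

/-- FLOOR(P₀) (verbatim the first hypothesis of `FluxTubeKepler.FloorGivesLayered`). -/
def Floor (P₀ : PeriodicConfiguration 3) : Prop :=
  ∀ (N : ℕ) (x : Fin N → E3), IsGroundState lennardJones x →
    (N : ℝ) * P₀.energyPerParticle lennardJones ≤ interactionEnergy lennardJones x

/-- MARGIN BUDGET with exponent `s` (verbatim `Lines/DecayingMarginRung.lean`). -/
def MarginBudget (s : ℝ) (P₀ : PeriodicConfiguration 3) : Prop :=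
  ∀ R η : ℝ, 0 < R → 0 < η → ∃ c : ℝ, 0 < c ∧
    ∀ (N : ℕ) (x : Fin N → E3), IsGroundState lennardJones x →
      c * (Nat.card {i : Fin N // ¬ LayeredGood R η x i} : ℝ) ≤
        (N : ℝ) ^ s * (interactionEnergy lennardJones x - (N : ℝ) * P₀.energyPerParticle lennardJones)

/-- Periodic windows along the sequence (verbatim). -/
def HasPeriodicWindows (x : (N : ℕ) → (Fin N → E3)) : Prop :=
  ∃ P : PeriodicConfiguration 3, ∀ R ε : ℝ, 0 < ε → ∃ᶠ N in atTop, ∃ t : E3,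
    (∀ q ∈ P.points, ‖q‖ ≤ R → ∃ i : Fin N, dist (x N i + t) q ≤ ε) ∧
    (∀ i : Fin N, ‖x N i + t‖ ≤ R → ∃ q ∈ P.points, dist (x N i + t) q ≤ ε)

/-- The graded family (verbatim). -/
def MarginRung (s : ℝ) : Prop :=
  ∀ P₀ : PeriodicConfiguration 3, Floor P₀ → MarginBudget s P₀ →
    ∀ x : (N : ℕ) → (Fin N → E3), (∀ N, IsGroundState lennardJones (x N)) → HasPeriodicWindows x

/-- The deciding rung (verbatim). -/
def DecayingMarginRung : Prop := ∀ s : ℝ, s < 1 / 3 → MarginRung s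

/-- At exponent `0` the margin budget IS the floor's budget. -/
theorem marginBudget_zero_iff (P₀ : PeriodicConfiguration 3) :
    MarginBudget 0 P₀ ↔
      ∀ R η : ℝ, 0 < R → 0 < η → ∃ c : ℝ, 0 < c ∧
        ∀ (N : ℕ) (x : Fin N → E3), IsGroundState lennardJones x →
          c * (Nat.card {i : Fin N // ¬ LayeredGood R η x i} : ℝ) ≤
            interactionEnergy lennardJones x - (N : ℝ) * P₀.energyPerParticle lennardJones := by
  simp only [MarginBudget, Real.rpow_zero, one_mul]

/-- **F3 witness.** `MarginRung 0` is the floor: `FloorGivesLayered_proof` then `PeriodicGivenLayered_holds`. -/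
theorem marginRung_zero : MarginRung 0 := fun P₀ hF hB x hx =>
  Theses.FluxTubeKepler.PeriodicGivenLayered_holds x hx
    (Theorems.FluxTubeKeplerFloorGivesLayered.FloorGivesLayered_proof P₀ hF
      ((marginBudget_zero_iff P₀).1 hB) x hx)

/-- The F3 instantiation in `example` form: the dial member at the floor's parameter, from the floor. -/
example : MarginRung 0 := by
  simpa [MarginRung] using marginRung_zero

/-- Under FLOOR the margin budget is monotone in the exponent. -/
theorem marginBudget_mono {s s' : ℝ} (h : s ≤ s') {P₀ : PeriodicConfiguration 3} (hF : Floor P₀) :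
    MarginBudget s P₀ → MarginBudget s' P₀ := by
  intro hB R η hR hη
  obtain ⟨c, hc, hcN⟩ := hB R η hR hη
  refine ⟨c, hc, fun N x hx => ?_⟩
  have hX : 0 ≤ interactionEnergy lennardJones x - (N : ℝ) * P₀.energyPerParticle lennardJones :=
    sub_nonneg.2 (hF N x hx)
  rcases Nat.eq_zero_or_pos N with rfl | hN
  · have hcard : Nat.card {i : Fin 0 // ¬ LayeredGood R η x i} = 0 := by simp
    rw [hcard]
    calc c * ((0 : ℕ) : ℝ) = 0 := by simp
      _ ≤ ((0 : ℕ) : ℝ) ^ s' *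
            (interactionEnergy lennardJones x - ((0 : ℕ) : ℝ) * P₀.energyPerParticle lennardJones) :=
          mul_nonneg (Real.rpow_nonneg (Nat.cast_nonneg 0) _) hX
  · have h1 : (1 : ℝ) ≤ N := by exact_mod_cast hN
    exact (hcN N x hx).trans
      (mul_le_mul_of_nonneg_right (Real.rpow_le_rpow_of_exponent_le h1 h) hX)

/-- `MarginRung` is antitone in the exponent. -/
theorem marginRung_anti {s s' : ℝ} (h : s ≤ s') : MarginRung s' → MarginRung s :=
  fun H P₀ hF hB x hx => H P₀ hF (marginBudget_mono h hF hB) x hx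

/-- The deciding rung gives back the floor member. -/
theorem marginRung_zero_of_decayingMarginRung (h : DecayingMarginRung) : MarginRung 0 :=
  h 0 (by norm_num)

end Summit.AtomisticToContinuum.Crystallization.Cruxes.FluxCellKepler.MarginLadder.Special

end
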